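import Literature.NumberTheory.LFunctions.RayClassGaussSum
import HarnessLib

/-!
# The absolute value of the Gauss sum of a primitive ray class character: `|τ_𝔪(χ_f, y)|² = 𝔑(𝔪)`

Topic `Literature/NumberTheory/LFunctions`; namespace `Literature.NumberTheory.LFunctions`.  Pure-proof
companion of `RayClassGaussSum.lean` (`finitePart`, `gaussSum`, Neukirch VII (6.3)–(6.4)): the last
clause of

> **Neukirch VII (6.4) Theorem.** For a primitive character `χ_f` of `(𝒪/𝔪)^*` and `y ∈ 𝔪⁻¹𝔡⁻¹`,
> "`|τ_𝔪(χ_f, y)| = √𝔑(𝔪)`, if `(y𝔪𝔡, 𝔪) = 1`."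

Neukirch proves it through the Möbius function and the sums `T_𝔞(y)`, `S_𝔞(y)` ((6.5)–(6.6)).  We give
the shorter standard argument, a deviation recorded here: by the two cases of (6.4) already proved
(`gaussSum_mul_of_isCoprime`, `gaussSum_mul_eq_zero_of_not_isCoprime`) one has
`χ̄_f(x) τ(y) = τ(xy)` for *all* `x` (`gaussSum_mul_eq`), so
`|τ(y)|² = Σ_x e^{-2πiTr(xy)} τ(xy) = Σ_z χ_f(z) Σ_x e^{2πi Tr(x(z-1)y)}`, and the inner sum over
`x mod 𝔪` of an additive character is `𝔑(𝔪)` or `0` according as `(z-1)y ∈ 𝔡⁻¹` or not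
(`sum_fourierChar_trace_eq`), i.e. (for `(y𝔪𝔡, 𝔪) = 1`) as `z ≡ 1 mod 𝔪` or not
(`mul_mem_dual_one_iff`).  Main result: `norm_gaussSum_sq` / `norm_gaussSum`.

## References

* J. Neukirch, *Algebraic Number Theory*, Grundlehren 322, Springer 1999, Ch. VII §6 Thm. (6.4) with
  (6.5)–(6.6). [NeukirchANT1999]
-/

noncomputable section

open scoped FourierTransform nonZeroDivisors
open NumberField NumberField.InfinitePlace IsDedekindDomain

namespace Literature.NumberTheory.LFunctions

variable {K : Type*} [Field K] [NumberField K]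
variable {𝔪 : Ideal (𝓞 K)} {ψ : HeightOneSpectrum (𝓞 K) → ℂ} {p : Finset {w : InfinitePlace K // IsReal w}}

/-! ## Sums of an additive character over `𝒪/𝔪` -/

/-- **`χ̄_f(x) τ(y) = τ(xy)` for every `x`** (both cases of Neukirch VII (6.4) at once; for `x` not prime
to `𝔪` both sides vanish). [cite: NeukirchANT1999, Ch. VII §6 Thm. (6.4)] -/
theorem gaussSum_mul_eq (hψ : IsRayClassCharacter 𝔪 ψ) (hp : IsSignType 𝔪 ψ p) (hprim : IsPrimitive 𝔪 ψ)
    (h𝔪 : 𝔪 ≠ ⊥) {x : 𝓞 K} (hx0 : x ≠ 0) {y : K} (hy : y ∈ FractionalIdeal.dual ℤ ℚ (𝔪 : FractionalIdeal (𝓞 K)⁰ K)) :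
    gaussSum K 𝔪 ψ p ((x : K) * y) = starRingEnd ℂ (finitePart K 𝔪 ψ p x) * gaussSum K 𝔪 ψ p y := by
  classical
  by_cases hx : IsCoprime (Ideal.span {x}) 𝔪
  · exact gaussSum_mul_of_isCoprime hψ hp h𝔪 hx0 hx hy
  · rw [finitePart_of_not (fun h ↦ hx h.2), map_zero, zero_mul]
    exact gaussSum_mul_eq_zero_of_not_isCoprime hψ hp hprim h𝔪 hx hy

/-- **Orthogonality**: for `w ∈ 𝔪⁻¹𝔡⁻¹`, `Σ_{x mod 𝔪} e^{2πi Tr(xw)} = 𝔑(𝔪)` if `w ∈ 𝔡⁻¹` and `= 0`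
otherwise (Neukirch VII (6.6), the sums `S_𝔞`: "we can find a class `z mod 𝔪` such that `Tr(zy) ∉ ℤ` …
`e^{2πi Tr(zy)} S_𝔞(y) = S_𝔞(y)`"). [cite: NeukirchANT1999, Ch. VII §6 Lemma (6.6)] -/
theorem sum_fourierChar_trace_eq_card [Fintype (𝓞 K ⧸ 𝔪)] (h𝔪 : 𝔪 ≠ ⊥) {w : K}
    (h1 : w ∈ FractionalIdeal.dual ℤ ℚ (1 : FractionalIdeal (𝓞 K)⁰ K)) :
    ∑ q : 𝓞 K ⧸ 𝔪, ((𝐞 ((Algebra.trace ℚ K ((liftNZ K 𝔪 q : K) * w) : ℚ) : ℝ) : Circle) : ℂ) =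
      (Fintype.card (𝓞 K ⧸ 𝔪) : ℂ) := by
  have _ := h𝔪
  have h10 : (1 : FractionalIdeal (𝓞 K)⁰ K) ≠ 0 := one_ne_zero
  have : ∀ q : 𝓞 K ⧸ 𝔪, ((𝐞 ((Algebra.trace ℚ K ((liftNZ K 𝔪 q : K) * w) : ℚ) : ℝ) : Circle) : ℂ) = 1 := by
    intro q
    obtain ⟨n, hn⟩ := (FractionalIdeal.mem_dual h10).mp h1 (liftNZ K 𝔪 q : K)
      ((FractionalIdeal.mem_one_iff _).mpr ⟨liftNZ K 𝔪 q, rfl⟩)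
    rw [Algebra.traceForm_apply, mul_comm] at hn
    rw [show ((Algebra.trace ℚ K ((liftNZ K 𝔪 q : K) * w) : ℚ) : ℝ) = (n : ℝ) by
      rw [← hn]; simp, Real.fourierChar_apply' (n : ℝ), Circle.exp_two_pi_mul_int, Circle.coe_one]
  simp only [this, Finset.sum_const, Finset.card_univ, nsmul_eq_mul, mul_one]

/-- **Orthogonality**: for `w ∈ 𝔪⁻¹𝔡⁻¹ ∖ 𝔡⁻¹`, `Σ_{x mod 𝔪} e^{2πi Tr(xw)} = 0` (Neukirch VII (6.6), the
sums `S_𝔞`: "we can find a class `z mod 𝔪` such that `Tr(zy) ∉ ℤ` … `e^{2πi Tr(zy)} S_𝔞(y) = S_𝔞(y)`",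
case `𝔞 = 1`). [cite: NeukirchANT1999, Ch. VII §6 Lemma (6.6)] -/
theorem sum_fourierChar_trace_eq_zero [Fintype (𝓞 K ⧸ 𝔪)] (h𝔪 : 𝔪 ≠ ⊥) {w : K}
    (hw : w ∈ FractionalIdeal.dual ℤ ℚ (𝔪 : FractionalIdeal (𝓞 K)⁰ K))
    (h1 : w ∉ FractionalIdeal.dual ℤ ℚ (1 : FractionalIdeal (𝓞 K)⁰ K)) :
    ∑ q : 𝓞 K ⧸ 𝔪, ((𝐞 ((Algebra.trace ℚ K ((liftNZ K 𝔪 q : K) * w) : ℚ) : ℝ) : Circle) : ℂ) = 0 := by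
  classical
  set F : 𝓞 K → ℂ := fun x ↦ ((𝐞 ((Algebra.trace ℚ K ((x : K) * w) : ℚ) : ℝ) : Circle) : ℂ) with hF
  -- `F` is `𝔪`-periodic
  have hper : ∀ x x' : 𝓞 K, x - x' ∈ 𝔪 → F x = F x' := by
    intro x x' h
    have : ((x : 𝓞 K) : K) = (x' : K) + ((x - x' : 𝓞 K) : K) := by push_cast; ring
    simp only [hF]
    rw [this, coe_fourierChar_trace_add_of_mem h𝔪 hw _ h]
  -- a shift `z` with `F z ≠ 1` permutes the classes
  obtain ⟨z, hz⟩ : ∃ z : 𝓞 K, F z ≠ 1 := by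
    by_contra hall
    push Not at hall
    apply h1
    have h10 : (1 : FractionalIdeal (𝓞 K)⁰ K) ≠ 0 := one_ne_zero
    rw [FractionalIdeal.mem_dual h10]
    intro a ha
    obtain ⟨a, rfl⟩ := (FractionalIdeal.mem_one_iff _).mp ha
    -- `e(Tr(a w)) = 1` ⟹ `Tr(a w) ∈ ℤ`
    have h := hall a
    simp only [hF, Real.fourierChar_apply] at h
    obtain ⟨n, hn⟩ := Complex.exp_eq_one_iff.mp h
    refine ⟨n, ?_⟩
    rw [Algebra.traceForm_apply, mul_comm]
    have : ((Algebra.trace ℚ K ((a : K) * w) : ℚ) : ℂ) = (n : ℂ) := by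
      have hI : (2 * Real.pi : ℂ) * Complex.I ≠ 0 := by simp [Real.pi_ne_zero]
      have := hn
      push_cast at this
      have h2 : ((Algebra.trace ℚ K ((a : K) * w) : ℚ) : ℂ) * (2 * Real.pi * Complex.I) = n * (2 * Real.pi * Complex.I) := by
        linear_combination this
      exact mul_right_cancel₀ hI h2
    exact_mod_cast this.symm
  have hshift : ∑ q : 𝓞 K ⧸ 𝔪, F (liftNZ K 𝔪 q) = F z * ∑ q : 𝓞 K ⧸ 𝔪, F (liftNZ K 𝔪 q) := by
    rw [Finset.mul_sum]
    refine (Fintype.sum_equiv (Equiv.addRight (Ideal.Quotient.mk 𝔪 z)) _ _ fun q ↦ ?_).symm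
    rw [Equiv.coe_addRight]
    -- `F (lift(q + z)) = F (lift q + z) = F z * F (lift q)`
    have hcong : F (liftNZ K 𝔪 (q + Ideal.Quotient.mk 𝔪 z)) = F (liftNZ K 𝔪 q + z) :=
      hper _ _ (by rw [← Ideal.Quotient.eq, map_add, mk_liftNZ h𝔪, mk_liftNZ h𝔪])
    rw [hcong]
    simp only [hF]
    push_cast
    rw [add_mul, map_add, Rat.cast_add, AddChar.map_add_eq_mul, Circle.coe_mul, mul_comm]
  have : (1 - F z) * ∑ q : 𝓞 K ⧸ 𝔪, F (liftNZ K 𝔪 q) = 0 := by linear_combination hshift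
  exact (mul_eq_zero.mp this).resolve_left (sub_ne_zero.mpr hz.symm)

/-- **For `(y𝔪𝔡, 𝔪) = 1` and `z ∈ 𝒪`: `zy ∈ 𝔡⁻¹ ⟺ z ∈ 𝔪`** (Neukirch, end of the proof of (6.4):
"`y(z-1) ∈ 𝔞⁻¹𝔡⁻¹ ⟺ z ≡ 1 mod 𝔪/𝔞`", case `𝔞 = 1`). [cite: NeukirchANT1999, Ch. VII §6 Thm. (6.4) (proof)] -/
theorem mul_mem_dual_one_iff (h𝔪 : 𝔪 ≠ ⊥) {y : K} {𝔶 : Ideal (𝓞 K)}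
    (h𝔶 : (𝔶 : FractionalIdeal (𝓞 K)⁰ K) = FractionalIdeal.spanSingleton (𝓞 K)⁰ y * 𝔪 * differentIdeal ℤ (𝓞 K))
    (hc : IsCoprime 𝔶 𝔪) (z : 𝓞 K) :
    (z : K) * y ∈ FractionalIdeal.dual ℤ ℚ (1 : FractionalIdeal (𝓞 K)⁰ K) ↔ z ∈ 𝔪 := by
  have hm0 := coeIdeal_ne_zero' (K := K) h𝔪
  have hd0 := coeIdeal_differentIdeal_ne_zero (K := K)
  have hy := mem_dual_of_coeIdeal_eq h𝔪 h𝔶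
  have hdual1 : FractionalIdeal.dual ℤ ℚ (1 : FractionalIdeal (𝓞 K)⁰ K) =
      ((differentIdeal ℤ (𝓞 K) : Ideal (𝓞 K)) : FractionalIdeal (𝓞 K)⁰ K)⁻¹ := by
    rw [coeIdeal_differentIdeal ℤ ℚ, inv_inv]
  constructor
  · intro h
    -- `(z)(y)𝔡 ≤ 1`, i.e. `(z)𝔶 ≤ 𝔪`
    rw [hdual1, ← FractionalIdeal.spanSingleton_le_iff_mem] at h
    have h' : ((Ideal.span {z} * 𝔶 : Ideal (𝓞 K)) : FractionalIdeal (𝓞 K)⁰ K) ≤ (𝔪 : FractionalIdeal (𝓞 K)⁰ K) := by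
      rw [FractionalIdeal.coeIdeal_mul, FractionalIdeal.coeIdeal_span_singleton, h𝔶]
      calc FractionalIdeal.spanSingleton (𝓞 K)⁰ (z : K) * (FractionalIdeal.spanSingleton (𝓞 K)⁰ y * 𝔪 * differentIdeal ℤ (𝓞 K))
          = (FractionalIdeal.spanSingleton (𝓞 K)⁰ ((z : K) * y) * differentIdeal ℤ (𝓞 K)) * 𝔪 := by
            rw [← FractionalIdeal.spanSingleton_mul_spanSingleton]; ring
        _ ≤ (((differentIdeal ℤ (𝓞 K) : Ideal (𝓞 K)) : FractionalIdeal (𝓞 K)⁰ K)⁻¹ * differentIdeal ℤ (𝓞 K)) * 𝔪 :=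
            mul_le_mul_of_nonneg_right (mul_le_mul_of_nonneg_right h zero_le) zero_le
        _ = 𝔪 := by rw [inv_mul_cancel₀ hd0, one_mul]
    have hle : Ideal.span {z} * 𝔶 ≤ 𝔪 := (FractionalIdeal.coeIdeal_le_coeIdeal K).mp h'
    have hdvd : 𝔪 ∣ Ideal.span {z} * 𝔶 := Ideal.dvd_iff_le.mpr hle
    have : 𝔪 ∣ Ideal.span {z} := (IsCoprime.symm hc).dvd_of_dvd_mul_right hdvd
    exact Ideal.mem_span_singleton_self z |> (Ideal.dvd_iff_le.mp this)
  · intro hz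
    have : (z : K) * y ∈ (𝔪 : FractionalIdeal (𝓞 K)⁰ K) * FractionalIdeal.dual ℤ ℚ (𝔪 : FractionalIdeal (𝓞 K)⁰ K) :=
      FractionalIdeal.mul_mem_mul (FractionalIdeal.mem_coeIdeal_of_mem _ hz) hy
    rwa [FractionalIdeal.self_mul_dual ℤ ℚ hm0] at this

/-- **`|τ_𝔪(χ_f, y)|² = 𝔑(𝔪)` for primitive `χ_f` and `(y𝔪𝔡, 𝔪) = 1`** (Neukirch VII (6.4), last
clause). [cite: NeukirchANT1999, Ch. VII §6 Thm. (6.4)] -/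
theorem normSq_gaussSum (hψ : IsRayClassCharacter 𝔪 ψ) (hp : IsSignType 𝔪 ψ p) (hprim : IsPrimitive 𝔪 ψ)
    (h𝔪 : 𝔪 ≠ ⊥) {y : K} {𝔶 : Ideal (𝓞 K)}
    (h𝔶 : (𝔶 : FractionalIdeal (𝓞 K)⁰ K) = FractionalIdeal.spanSingleton (𝓞 K)⁰ y * 𝔪 * differentIdeal ℤ (𝓞 K))
    (hc : IsCoprime 𝔶 𝔪) :
    starRingEnd ℂ (gaussSum K 𝔪 ψ p y) * gaussSum K 𝔪 ψ p y = (Ideal.absNorm 𝔪 : ℂ) := by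
  classical
  haveI : Finite (𝓞 K ⧸ 𝔪) := Ideal.finiteQuotientOfFreeOfNeBot 𝔪 h𝔪
  haveI : Fintype (𝓞 K ⧸ 𝔪) := Fintype.ofFinite _
  have hy := mem_dual_of_coeIdeal_eq h𝔪 h𝔶
  set r : 𝓞 K ⧸ 𝔪 → 𝓞 K := liftNZ K 𝔪 with hr
  set e : K → ℂ := fun t ↦ ((𝐞 ((Algebra.trace ℚ K t : ℚ) : ℝ) : Circle) : ℂ) with he
  have he_add : ∀ t t' : K, e (t + t') = e t * e t' := fun t t' ↦ by
    simp only [he, map_add, Rat.cast_add, AddChar.map_add_eq_mul, Circle.coe_mul]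
  have he_neg : ∀ t : K, e (-t) * e t = 1 := fun t ↦ by
    rw [← he_add, neg_add_cancel]; simp [he]
  have hτ : gaussSum K 𝔪 ψ p y = ∑ q, finitePart K 𝔪 ψ p (r q) * e ((r q : K) * y) :=
    gaussSum_eq_sum hψ hp h𝔪 hy r (liftNZ_ne_zero h𝔪) (mk_liftNZ h𝔪)
  -- `conj τ · τ = Σ_q conj χ_f(r_q) e(-Tr(r_q y)) τ = Σ_q e(-r_q y) τ(r_q y)`
  have hconj_e : ∀ q, starRingEnd ℂ (e ((r q : K) * y)) = e (-((r q : K) * y)) := fun q ↦ by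
    simp only [he, Real.fourierChar_apply, ← Complex.exp_conj, map_mul, Complex.conj_ofReal, Complex.conj_I,
      mul_neg, map_neg, Rat.cast_neg, Complex.ofReal_neg, neg_mul]
  have hconjτ : starRingEnd ℂ (gaussSum K 𝔪 ψ p y) =
      ∑ q, starRingEnd ℂ (finitePart K 𝔪 ψ p (r q)) * e (-((r q : K) * y)) := by
    rw [hτ, map_sum]
    exact Finset.sum_congr rfl fun q _ ↦ by rw [map_mul, hconj_e]
  have step1 : starRingEnd ℂ (gaussSum K 𝔪 ψ p y) * gaussSum K 𝔪 ψ p y =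
      ∑ q, e (-((r q : K) * y)) * gaussSum K 𝔪 ψ p ((r q : K) * y) := by
    rw [hconjτ, Finset.sum_mul]
    refine Finset.sum_congr rfl fun q _ ↦ ?_
    rw [gaussSum_mul_eq hψ hp hprim h𝔪 (liftNZ_ne_zero h𝔪 q) hy]
    ring
  -- expand `τ(r_q y)` and swap
  have step2 : ∑ q, e (-((r q : K) * y)) * gaussSum K 𝔪 ψ p ((r q : K) * y) =
      ∑ q', finitePart K 𝔪 ψ p (r q') * ∑ q, e ((r q : K) * (((r q' - 1 : 𝓞 K) : K) * y)) := by
    have hexp : ∀ q, gaussSum K 𝔪 ψ p ((r q : K) * y) = ∑ q', finitePart K 𝔪 ψ p (r q') * e ((r q' : K) * ((r q : K) * y)) :=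
      fun q ↦ gaussSum_eq_sum hψ hp h𝔪 (coe_mul_mem_dual hy _) r (liftNZ_ne_zero h𝔪) (mk_liftNZ h𝔪)
    simp_rw [hexp, Finset.mul_sum]
    rw [Finset.sum_comm]
    refine Finset.sum_congr rfl fun q' _ ↦ ?_
    refine Finset.sum_congr rfl fun q _ ↦ ?_
    have : (r q : K) * (((r q' - 1 : 𝓞 K) : K) * y) = -((r q : K) * y) + (r q' : K) * ((r q : K) * y) := by push_cast; ring
    rw [this, he_add]; ring
  -- the inner sums
  have step3 : ∀ q', ∑ q, e ((r q : K) * (((r q' - 1 : 𝓞 K) : K) * y)) =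
      if r q' - 1 ∈ 𝔪 then (Fintype.card (𝓞 K ⧸ 𝔪) : ℂ) else 0 := by
    intro q'
    split_ifs with hq'
    · exact sum_fourierChar_trace_eq_card h𝔪 ((mul_mem_dual_one_iff h𝔪 h𝔶 hc _).mpr hq')
    · exact sum_fourierChar_trace_eq_zero h𝔪 (coe_mul_mem_dual hy _)
        (fun h ↦ hq' ((mul_mem_dual_one_iff h𝔪 h𝔶 hc _).mp h))
  rw [step1, step2]
  simp_rw [step3, mul_ite, mul_zero]
  rw [Finset.sum_ite, Finset.sum_const_zero, add_zero]
  -- only the class of `1` survives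
  have hfilter : (Finset.univ.filter fun q' : 𝓞 K ⧸ 𝔪 ↦ r q' - 1 ∈ 𝔪) = {Ideal.Quotient.mk 𝔪 1} := by
    ext q'
    simp only [Finset.mem_filter, Finset.mem_univ, true_and, Finset.mem_singleton]
    rw [← Ideal.Quotient.eq, mk_liftNZ h𝔪, map_one]
  rw [hfilter, Finset.sum_singleton, finitePart_eq_one_of_sub_one_mem hp (liftNZ_ne_zero h𝔪 _) (by
    rw [← Ideal.Quotient.eq, mk_liftNZ h𝔪, map_one]), one_mul, Ideal.absNorm_apply, Submodule.cardQuot_apply,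
    Nat.card_eq_fintype_card]

/-- **`|τ_𝔪(χ_f, y)| = √𝔑(𝔪)`** (Neukirch VII (6.4)). [cite: NeukirchANT1999, Ch. VII §6 Thm. (6.4)] -/
theorem norm_gaussSum (hψ : IsRayClassCharacter 𝔪 ψ) (hp : IsSignType 𝔪 ψ p) (hprim : IsPrimitive 𝔪 ψ)
    (h𝔪 : 𝔪 ≠ ⊥) {y : K} {𝔶 : Ideal (𝓞 K)}
    (h𝔶 : (𝔶 : FractionalIdeal (𝓞 K)⁰ K) = FractionalIdeal.spanSingleton (𝓞 K)⁰ y * 𝔪 * differentIdeal ℤ (𝓞 K))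
    (hc : IsCoprime 𝔶 𝔪) :
    ‖gaussSum K 𝔪 ψ p y‖ = Real.sqrt (Ideal.absNorm 𝔪) := by
  have h := normSq_gaussSum hψ hp hprim h𝔪 h𝔶 hc
  rw [← Complex.normSq_eq_conj_mul_self, Complex.normSq_eq_norm_sq] at h
  have h' : ‖gaussSum K 𝔪 ψ p y‖ ^ 2 = (Ideal.absNorm 𝔪 : ℝ) := by exact_mod_cast h
  rw [← h', Real.sqrt_sq (norm_nonneg _)]

end Literature.NumberTheory.LFunctions
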